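import Summits.RiemannHypothesis.RiemannHypothesis.Theorems.JensenPolynomialsStripContourShift

/-!
# Route `JensenPolynomials`, FAR crux `XiWindowZeroFreeRelFar` (B1-rel far) — S3 step 1: the main part `J(M,υ,a)` on the
shifted contour (RH-FREE; cell rh-jensen, HUMAN RULING D-0040)

Theory g8's line «far-gumbel» (skeleton v3, sha16 `69a41b651df70375`, item `stmt-RiemannHypothesis-19465`) isolates the main
part of the kernel integral as `winJ M υ a = ∫_{υ−2}^∞ Φ(u)·u·(u² + a)^{M−½} du` (principal power), for the far mode `υ ≥ 189/20`
and `‖a‖ ≤ (9/25)υ²`. Stub S3 `stub_laplaceFar` (eng-4 g3) evaluates it along the contour `[υ−2, υ−2+iy] ∪ {Im u = y}`,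
`|y| ≤ 1/10 < π/8`. This file is that first step, an instance of the «rectShift» brick
`WindowEGF.integral_Ioi_deBruijnPhiC_mul_eq_shift_add` (p441121):

* `re_sq_add_pos`: on the closed half-strip `Re u ≥ υ − 2`, `|Im u| ≤ 1/10` one has `Re(u² + a) > 0` (indeed `≥ 23`), so
  `G(u) = u·(u² + a)^{M−½}` is holomorphic there (`differentiableOn_farG`) and `‖G(x+it)‖ ≤ (2e⁴)^{M−½}·e^{2Mx}` (`norm_farG_le`);
* `winJ_integrand_eq_shift`: the three integrals converge and
  `∫_{υ−2}^∞ Φ(u)u(u²+a)^{M−½} du = ∫_{υ−2}^∞ Φ_C(x+iy)G(x+iy) dx + i∫₀^y Φ_C(υ−2+it)G(υ−2+it) dt`.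

The left side is `winJ M υ a` of the skeleton's objects (`Theorems/JensenPolynomialsFarGumbelDefs.lean`, p445603 in review)
by `rfl`; it is spelled out here so that this file does not wait for the definitions. WHAT THIS IS NOT: Cauchy's theorem
for an explicit integrand; nothing here bears on the zeros of `ζ` or the truth of RH.
-/

noncomputable section
-- D-0017: `Summit.RiemannHypothesis.RiemannHypothesis.…` duplicates the namespace BY DESIGN (single-problem summit).
set_option linter.dupNamespace false

namespace Summit.RiemannHypothesis.RiemannHypothesis.Theorems.JensenPolynomials.FarGumbel

open Literature.NumberTheory.LFunctions MeasureTheory Set Filter Complex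
open Summit.RiemannHypothesis.RiemannHypothesis.Theorems.JensenPolynomials.WindowEGF
open scoped Real

/-! ## 1. The half-strip `Re u ≥ υ − 2`, `|Im u| ≤ 1/10` -/

/-- On the closed half-strip `x ≥ υ − 2`, `|t| ≤ 1/10` (`υ ≥ 189/20`, `‖a‖ ≤ (9/25)υ²`): `Re((x+it)² + a) ≥ 23 > 0`. -/
theorem re_sq_add_ge {υ : ℝ} (hυ : (189 / 20 : ℝ) ≤ υ) {a : ℂ} (ha : ‖a‖ ≤ (9 / 25 : ℝ) * υ ^ 2) {x t : ℝ}
    (hx : υ - 2 ≤ x) (ht : |t| ≤ 1 / 10) : (23 : ℝ) ≤ (((x : ℂ) + t * I) ^ 2 + a).re := by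
  have hre : (((x : ℂ) + t * I) ^ 2 + a).re = x ^ 2 - t ^ 2 + a.re := by
    simp [sq, Complex.add_re, Complex.mul_re, Complex.mul_im]
  rw [hre]
  have h1 : -‖a‖ ≤ a.re := by
    have := Complex.abs_re_le_norm a
    rw [abs_le] at this; exact this.1
  have h2 : t ^ 2 ≤ 1 / 100 := by
    have := abs_le.mp ht
    nlinarith
  have hx0 : 0 ≤ x := by linarith
  have h3 : (υ - 2) ^ 2 ≤ x ^ 2 := by
    have : 0 ≤ υ - 2 := by linarith
    exact pow_le_pow_left₀ this hx 2
  nlinarith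

/-- `(x + it)² + a` lies in the slit plane (positive real part) on the half-strip. -/
theorem sq_add_mem_slitPlane {υ : ℝ} (hυ : (189 / 20 : ℝ) ≤ υ) {a : ℂ} (ha : ‖a‖ ≤ (9 / 25 : ℝ) * υ ^ 2) {x t : ℝ}
    (hx : υ - 2 ≤ x) (ht : |t| ≤ 1 / 10) : ((x : ℂ) + t * I) ^ 2 + a ∈ slitPlane := by
  rw [mem_slitPlane_iff]
  left
  linarith [re_sq_add_ge hυ ha hx ht]

/-- Points of the set `Ici (υ−2) ×ℂ uIcc 0 y` with `|y| ≤ 1/10` have the form `x + it`, `x ≥ υ − 2`, `|t| ≤ 1/10`. -/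
theorem exists_eq_mk_of_mem {υ y : ℝ} (hy : |y| ≤ 1 / 10) {u : ℂ} (hu : u ∈ (Ici (υ - 2) ×ℂ uIcc 0 y : Set ℂ)) :
    υ - 2 ≤ u.re ∧ |u.im| ≤ 1 / 10 ∧ u = (u.re : ℂ) + u.im * I := by
  refine ⟨hu.1, ?_, (Complex.re_add_im u).symm.trans (by simp [mul_comm])⟩
  have h : u.im ∈ uIcc 0 y := hu.2
  rcases le_total 0 y with h0 | h0
  · rw [uIcc_of_le h0] at h
    rw [abs_le] at hy ⊢; constructor <;> linarith [h.1, h.2]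
  · rw [uIcc_of_ge h0] at h
    rw [abs_le] at hy ⊢; constructor <;> linarith [h.1, h.2]

/-! ## 2. The holomorphic factor `G(u) = u·(u² + a)^{M−½}` -/

/-- `G(u) = u·(u²+a)^{M−½}` is complex-differentiable on the half-strip `Ici (υ−2) ×ℂ [[0, y]]`, `|y| ≤ 1/10`. -/
theorem differentiableOn_farG (M : ℕ) {υ : ℝ} (hυ : (189 / 20 : ℝ) ≤ υ) {a : ℂ} (ha : ‖a‖ ≤ (9 / 25 : ℝ) * υ ^ 2)
    {y : ℝ} (hy : |y| ≤ 1 / 10) :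
    DifferentiableOn ℂ (fun u : ℂ => u * (u ^ 2 + a) ^ ((M : ℂ) - 1 / 2)) (Ici (υ - 2) ×ℂ uIcc 0 y) := by
  intro u hu
  obtain ⟨hx, ht, hueq⟩ := exists_eq_mk_of_mem hy hu
  have hslit : u ^ 2 + a ∈ slitPlane := by
    rw [hueq]; exact sq_add_mem_slitPlane hυ ha hx ht
  have h1 : DifferentiableAt ℂ (fun u : ℂ => u ^ 2 + a) u := by fun_prop
  have h2 : DifferentiableAt ℂ (fun u : ℂ => (u ^ 2 + a) ^ ((M : ℂ) - 1 / 2)) u := h1.cpow_const hslit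
  exact (differentiableAt_id.mul h2).differentiableWithinAt

/-- The exponent `M − ½` as a complex number has real part `M − ½` and zero imaginary part. -/
theorem re_im_natCast_sub_half (M : ℕ) : ((M : ℂ) - 1 / 2).re = (M : ℝ) - 1 / 2 ∧ ((M : ℂ) - 1 / 2).im = 0 := by
  constructor
  · simp
  · simp

/-- Norm of the principal power with a real exponent: `‖z^{M−½}‖ = ‖z‖^{M−½}` for `z ≠ 0`. -/
theorem norm_cpow_natCast_sub_half {z : ℂ} (hz : z ≠ 0) (M : ℕ) :
    ‖z ^ ((M : ℂ) - 1 / 2)‖ = ‖z‖ ^ ((M : ℝ) - 1 / 2) := by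
  rw [norm_cpow_of_ne_zero hz, (re_im_natCast_sub_half M).1, (re_im_natCast_sub_half M).2, mul_zero, Real.exp_zero,
    div_one]

/-- Exponential bound of the holomorphic factor on the half-strip: for `x ≥ υ − 2` (`υ ≥ 189/20`), `|t| ≤ 1/10`,
`‖a‖ ≤ (9/25)υ²`: `‖(x+it)·((x+it)² + a)^{M−½}‖ ≤ (2e⁴)^{M−½}·e^{2M·x}`. -/
theorem norm_farG_le (M : ℕ) (hM : 1 ≤ M) {υ : ℝ} (hυ : (189 / 20 : ℝ) ≤ υ) {a : ℂ} (ha : ‖a‖ ≤ (9 / 25 : ℝ) * υ ^ 2)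
    {x t : ℝ} (hx : υ - 2 ≤ x) (ht : |t| ≤ 1 / 10) :
    ‖((x : ℂ) + t * I) * (((x : ℂ) + t * I) ^ 2 + a) ^ ((M : ℂ) - 1 / 2)‖ ≤
      (2 * Real.exp 4) ^ ((M : ℝ) - 1 / 2) * Real.exp (2 * M * x) := by
  set u : ℂ := (x : ℂ) + t * I with hu
  have hx0 : 0 ≤ x := by linarith
  have hMr : (0 : ℝ) ≤ (M : ℝ) - 1 / 2 := by
    have : (1 : ℝ) ≤ M := by exact_mod_cast hM
    linarith
  have hz : u ^ 2 + a ≠ 0 := by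
    intro h
    have := re_sq_add_ge hυ ha hx ht
    rw [← hu] at this
    rw [h, Complex.zero_re] at this
    linarith
  -- `‖u‖ ≤ x + 1/10 ≤ e^x`
  have hnu : ‖u‖ ≤ x + 1 / 10 := by
    calc ‖u‖ ≤ ‖(x : ℂ)‖ + ‖(t : ℂ) * I‖ := norm_add_le _ _
      _ = |x| + |t| := by simp
      _ ≤ x + 1 / 10 := by rw [abs_of_nonneg hx0]; linarith
  have hnu' : ‖u‖ ≤ Real.exp x := by
    have h1 : x + 1 ≤ Real.exp x := Real.add_one_le_exp x
    linarith
  -- `‖u² + a‖ ≤ (x + 1/10)² + (9/25)υ² ≤ 2e⁴·e^{2x}`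
  have hυx : υ ≤ x + 2 := by linarith
  have hsq : ‖u ^ 2 + a‖ ≤ 2 * Real.exp 4 * Real.exp (2 * x) := by
    have h1 : ‖u ^ 2 + a‖ ≤ (x + 1 / 10) ^ 2 + (9 / 25 : ℝ) * υ ^ 2 := by
      calc ‖u ^ 2 + a‖ ≤ ‖u ^ 2‖ + ‖a‖ := norm_add_le _ _
        _ = ‖u‖ ^ 2 + ‖a‖ := by rw [norm_pow]
        _ ≤ (x + 1 / 10) ^ 2 + (9 / 25 : ℝ) * υ ^ 2 := by
            gcongr
    have h2 : (x + 1 / 10) ^ 2 + (9 / 25 : ℝ) * υ ^ 2 ≤ 2 * (x + 2) ^ 2 := by nlinarith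
    have h3 : x + 2 ≤ Real.exp (x + 2) := by linarith [Real.add_one_le_exp (x + 2)]
    have h4 : (x + 2) ^ 2 ≤ Real.exp (x + 2) ^ 2 := pow_le_pow_left₀ (by linarith) h3 2
    have h5 : Real.exp (x + 2) ^ 2 = Real.exp 4 * Real.exp (2 * x) := by
      rw [← Real.exp_nat_mul, ← Real.exp_add]; congr 1; push_cast; ring
    linarith
  -- assemble
  rw [norm_mul, norm_cpow_natCast_sub_half hz M]
  have hpow : ‖u ^ 2 + a‖ ^ ((M : ℝ) - 1 / 2) ≤ (2 * Real.exp 4 * Real.exp (2 * x)) ^ ((M : ℝ) - 1 / 2) :=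
    Real.rpow_le_rpow (norm_nonneg _) hsq hMr
  have hsplit : (2 * Real.exp 4 * Real.exp (2 * x)) ^ ((M : ℝ) - 1 / 2) =
      (2 * Real.exp 4) ^ ((M : ℝ) - 1 / 2) * Real.exp (2 * x * ((M : ℝ) - 1 / 2)) := by
    rw [Real.mul_rpow (by positivity) (Real.exp_pos _).le, ← Real.exp_mul]
  have hexp : Real.exp (2 * x * ((M : ℝ) - 1 / 2)) * Real.exp x ≤ Real.exp (2 * M * x) := by
    rw [← Real.exp_add]
    apply Real.exp_monotone
    nlinarith
  calc ‖u‖ * ‖u ^ 2 + a‖ ^ ((M : ℝ) - 1 / 2)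
      ≤ Real.exp x * ((2 * Real.exp 4) ^ ((M : ℝ) - 1 / 2) * Real.exp (2 * x * ((M : ℝ) - 1 / 2))) := by
        rw [← hsplit]
        exact mul_le_mul hnu' hpow (Real.rpow_nonneg (norm_nonneg _) _) (Real.exp_pos _).le
    _ = (2 * Real.exp 4) ^ ((M : ℝ) - 1 / 2) * (Real.exp (2 * x * ((M : ℝ) - 1 / 2)) * Real.exp x) := by ring
    _ ≤ (2 * Real.exp 4) ^ ((M : ℝ) - 1 / 2) * Real.exp (2 * M * x) :=
        mul_le_mul_of_nonneg_left hexp (Real.rpow_nonneg (by positivity) _)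

/-! ## 3. The shift -/

/-- **S3, step 1: the main part on the shifted contour.** For `M ≥ 1`, the far mode range `υ ≥ 189/20`, `‖a‖ ≤ (9/25)υ²`
and a height `|y| ≤ 1/10`: the integrand of `winJ M υ a` equals `Φ_C·G` on the ray, both rays are integrable, and
`∫_{υ−2}^∞ Φ(u)·u·(u² + a)^{M−½} du = ∫_{υ−2}^∞ Φ_C(x+iy)·G(x+iy) dx + i·∫₀^y Φ_C(υ−2+it)·G(υ−2+it) dt`
with `G(u) = u·(u² + a)^{M−½}`. -/
theorem winJ_integrand_eq_shift (M : ℕ) (hM : 1 ≤ M) {υ : ℝ} (hυ : (189 / 20 : ℝ) ≤ υ) {a : ℂ}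
    (ha : ‖a‖ ≤ (9 / 25 : ℝ) * υ ^ 2) {y : ℝ} (hy : |y| ≤ 1 / 10) :
    IntegrableOn (fun x : ℝ => deBruijnPhiC x * ((x : ℂ) * ((x : ℂ) ^ 2 + a) ^ ((M : ℂ) - 1 / 2))) (Ioi (υ - 2)) ∧
    IntegrableOn (fun x : ℝ => deBruijnPhiC (x + y * I) *
      (((x : ℂ) + y * I) * (((x : ℂ) + y * I) ^ 2 + a) ^ ((M : ℂ) - 1 / 2))) (Ioi (υ - 2)) ∧
    (∫ u in Ioi (υ - 2), ((deBruijnPhi u * u : ℝ) : ℂ) * (((u : ℂ) ^ 2 + a) ^ ((M : ℂ) - 1 / 2))) =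
      (∫ x in Ioi (υ - 2), deBruijnPhiC (x + y * I) *
          (((x : ℂ) + y * I) * (((x : ℂ) + y * I) ^ 2 + a) ^ ((M : ℂ) - 1 / 2))) +
        I * ∫ t in (0 : ℝ)..y, deBruijnPhiC ((υ - 2 : ℝ) + t * I) *
          ((((υ - 2 : ℝ) : ℂ) + t * I) * ((((υ - 2 : ℝ) : ℂ) + t * I) ^ 2 + a) ^ ((M : ℂ) - 1 / 2)) := by
  have ha0 : 0 ≤ υ - 2 := by linarith
  have hy4 : 4 * (1 / 10 : ℝ) < π / 2 := by linarith [Real.pi_gt_three]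
  have hG := differentiableOn_farG M hυ ha hy
  have hGb : ∀ x t : ℝ, υ - 2 ≤ x → t ∈ uIcc 0 y →
      ‖(fun u : ℂ => u * (u ^ 2 + a) ^ ((M : ℂ) - 1 / 2)) (x + t * I)‖ ≤
        (2 * Real.exp 4) ^ ((M : ℝ) - 1 / 2) * Real.exp (2 * M * x) := by
    intro x t hx ht
    have ht' : |t| ≤ 1 / 10 := (exists_eq_mk_of_mem hy (mk_mem_halfStrip hx ht)).2.1 |> fun h => by simpa using h
    exact norm_farG_le M hM hυ ha hx ht'
  obtain ⟨h0, h1, h2⟩ := integral_Ioi_deBruijnPhiC_mul_eq_shift_add (G := fun u : ℂ => u * (u ^ 2 + a) ^ ((M : ℂ) - 1 / 2))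
    (K := 2 * M) ha0 hy hy4 hG hGb
  refine ⟨h0, h1, ?_⟩
  -- identify the real-axis integrand
  have hint : (∫ u in Ioi (υ - 2), ((deBruijnPhi u * u : ℝ) : ℂ) * (((u : ℂ) ^ 2 + a) ^ ((M : ℂ) - 1 / 2))) =
      ∫ x in Ioi (υ - 2), deBruijnPhiC x * ((x : ℂ) * ((x : ℂ) ^ 2 + a) ^ ((M : ℂ) - 1 / 2)) := by
    refine setIntegral_congr_fun measurableSet_Ioi fun x _ => ?_
    rw [deBruijnPhiC_ofReal]; push_cast; ring
  rw [hint, h2]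

end Summit.RiemannHypothesis.RiemannHypothesis.Theorems.JensenPolynomials.FarGumbel

end
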